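import Summits.RiemannHypothesis.RiemannHypothesis.Theorems.GroundBartaPolarPerronFrobeniusSmoothAbs
import Literature.NumberTheory.LFunctions.WeilArchimedeanPositivityProofs
import Literature.NumberTheory.LFunctions.WeilWindowSimpleEven
import Literature.NumberTheory.LFunctions.WeilWindowSuzukiProofs
import Mathlib.Analysis.Calculus.BumpFunction.Basic
import HarnessLib

/-!
# RiemannHypothesis / GroundBarta — crux `PolarPerronFrobenius` (stmt-RiemannHypothesis-18390):
# the windowed Weil form is NOT sign-improving at windows `a ≥ 3/10` (certified barrier, RH-free)

Helper file (`--supports`), RH-free, Mathlib + proved tree files only, no definitions.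

The small-window Perron–Frobenius theorem (`…SmallWindows.lean`) rests on the sign-improving
inequality `Re Q(|f|) ≤ Re Q(f)` for real window tests, valid while `2 cosh a ≤ w(2a)`
(`w(t) = e^{t/2}/(2 sinh t)`), i.e. `a ≤ 0.1406…`.  This file certifies that the inequality FAILS at
every window `a ≥ 3/10` (and, parametrically, as soon as the window accommodates a separation `α`
with `w(α) < 2cosh(α/2)` below the first prime length `log 2`): there are smooth NON-NEGATIVE bumps
`p, q` with disjoint supports in `[-a, a]` — so `f = p − q` is a real window test with `|f| = p + q`
again a test — such that

  `Re Q(p + q) − Re Q(p − q) = 4 Re W(p ⋆ q̃) ≥ 4 (2cosh(α/2) − w(α)) ∫p ∫q > 0`.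

Indeed the cross kernel `k = p ⋆ q̃ ≥ 0` is supported in `[α, β] ⊂ (0, log 2)`, so in the explicit
formula `W(k) = k̂(0) + k̂(1) − Σ Λ(n)n^{-1/2}(k(log n)+k(−log n)) + W_∞(k)` the prime term vanishes,
the polar term is `∫ k · 2cosh(t/2) ≥ 2cosh(α/2)∫k`, and Bombieri's archimedean term is
`−∫₀^∞ w(t) k(t) dt ≥ −w(α)∫k` (`k(0) = 0`, `k(−t) = 0`).  Consequently NO Beurling–Deny / Jentzsch
argument (`|u|` lowers the energy) can prove one-signedness of the bottom of the windowed Weil form at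
windows `a ≥ 3/10`: the RH-bearing content of the crux (cofinal windows) needs the structure of
near-minimisers (cf. the sign-defect criterion `…SignDefectCriterion.lean`).
Prover B, speedrun unit `sr-gb-rung-b` (rung 3).

References: E. Bombieri, Rend. Lincei (9) 11 (2000) Thm 2; H. Yoshida (1992) §2 (no prime below `log 2`).
-/

set_option linter.dupNamespace false

noncomputable section

open Set MeasureTheory Filter Complex
open scoped Real Topology ComplexConjugate

namespace Summit.RiemannHypothesis.RiemannHypothesis.Theorems.PolarPerronFrobenius

open Literature.NumberTheory.LFunctions

/-! ## The cross kernel `k = p ⋆ q̃` of two real functions -/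

section CrossKernel

variable {p q : ℝ → ℝ}

/-- `(p ⋆ q̃)(t) = ∫ p(u) q(u − t) du` (cast of a real integral) for real `p, q`. [folklore] -/
theorem sw_cross_apply (p q : ℝ → ℝ) (t : ℝ) :
    weilConv (fun u => ((p u : ℝ) : ℂ)) (weilReflect fun u => ((q u : ℝ) : ℂ)) t =
      ((∫ u, p u * q (u - t) : ℝ) : ℂ) := by
  rw [weilConv_apply, ← integral_complex_ofReal]
  congr 1 with u
  simp only [weilReflect, Complex.conj_ofReal, neg_sub]
  push_cast
  ring

/-- The swapped kernel is the reflected one: `(q ⋆ p̃)(t) = (p ⋆ q̃)(−t)`. [folklore] -/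
theorem sw_cross_swap (p q : ℝ → ℝ) (t : ℝ) :
    weilConv (fun u => ((q u : ℝ) : ℂ)) (weilReflect fun u => ((p u : ℝ) : ℂ)) t =
      weilConv (fun u => ((p u : ℝ) : ℂ)) (weilReflect fun u => ((q u : ℝ) : ℂ)) (-t) := by
  rw [sw_cross_apply, sw_cross_apply]
  congr 1
  rw [← integral_sub_right_eq_self (fun u => p u * q (u - -t)) t]
  congr 1 with u
  rw [show u - t - -t = u by ring]
  ring

/-- The cross kernel of non-negative functions is pointwise real and non-negative. [folklore] -/
theorem sw_cross_re_nonneg (hp : ∀ u, 0 ≤ p u) (hq : ∀ u, 0 ≤ q u) (t : ℝ) :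
    0 ≤ (weilConv (fun u => ((p u : ℝ) : ℂ)) (weilReflect fun u => ((q u : ℝ) : ℂ)) t).re := by
  rw [sw_cross_apply, Complex.ofReal_re]
  exact integral_nonneg fun u => mul_nonneg (hp u) (hq _)

/-- The cross kernel is the cast of its real part. [folklore] -/
theorem sw_cross_eq_ofReal_re (p q : ℝ → ℝ) (t : ℝ) :
    weilConv (fun u => ((p u : ℝ) : ℂ)) (weilReflect fun u => ((q u : ℝ) : ℂ)) t =
      (((weilConv (fun u => ((p u : ℝ) : ℂ)) (weilReflect fun u => ((q u : ℝ) : ℂ)) t).re : ℝ) : ℂ) := by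
  rw [sw_cross_apply, Complex.ofReal_re]

end CrossKernel

/-! ## Polarisation: `Q(p + q) − Q(p − q) = 4 W(p ⋆ q̃)` for real tests -/

/-- For real tests `p, q`: `Q(p + q) − Q(p − q) = 4 W(p ⋆ q̃)` (`W` is even, the cross kernels are
`k` and `k(−·)`). [folklore] -/
theorem sw_weilQuadratic_add_sub_sub {p q : ℝ → ℝ} (hP : IsWeilTest fun u => ((p u : ℝ) : ℂ))
    (hQ : IsWeilTest fun u => ((q u : ℝ) : ℂ)) :
    weilQuadratic (fun u => ((p u + q u : ℝ) : ℂ)) - weilQuadratic (fun u => ((p u - q u : ℝ) : ℂ)) =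
      4 * weilFunctional (weilConv (fun u => ((p u : ℝ) : ℂ)) (weilReflect fun u => ((q u : ℝ) : ℂ))) := by
  set P : ℝ → ℂ := fun u => ((p u : ℝ) : ℂ) with hPdef
  set Qc : ℝ → ℂ := fun u => ((q u : ℝ) : ℂ) with hQdef
  set Qm : ℝ → ℂ := fun u => (-1 : ℂ) * Qc u with hQmdef
  have hQm : IsWeilTest Qm := hQ.const_mul (-1)
  have e1 : (fun u => ((p u + q u : ℝ) : ℂ)) = P + Qc := by
    funext u; simp only [Pi.add_apply, hPdef, hQdef]; push_cast; ring
  have e2 : (fun u => ((p u - q u : ℝ) : ℂ)) = P + Qm := by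
    funext u; simp only [Pi.add_apply, hPdef, hQdef, hQmdef]; push_cast; ring
  rw [e1, e2, weilQuadratic_add hP hQ, weilQuadratic_add hP hQm]
  -- the cross terms of `P + Qm`
  have hQmQ : weilQuadratic Qm = weilQuadratic Qc := by
    rw [hQmdef, weilQuadratic_const_mul]; simp
  have hr : weilReflect Qm = fun t => (-1 : ℂ) * weilReflect Qc t := by
    rw [hQmdef, weilReflect_const_mul]; simp
  have hc1 : weilFunctional (weilConv P (weilReflect Qm)) = -weilFunctional (weilConv P (weilReflect Qc)) := by
    rw [hr, weilConv_const_mul_right, weilFunctional_const_mul]; ring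
  have hc2 : weilFunctional (weilConv Qm (weilReflect P)) = -weilFunctional (weilConv Qc (weilReflect P)) := by
    rw [hQmdef, weilConv_const_mul_left, weilFunctional_const_mul]; ring
  -- the swapped kernel is the reflected kernel, and `W` is even
  have hswap : weilConv Qc (weilReflect P) = fun t => weilConv P (weilReflect Qc) (-t) := by
    funext t; exact sw_cross_swap p q t
  have hsw : weilFunctional (weilConv Qc (weilReflect P)) = weilFunctional (weilConv P (weilReflect Qc)) := by
    rw [hswap, weilFunctional_comp_neg]
  rw [hQmQ, hc1, hc2, hsw]
  ring

/-! ## The explicit formula on a non-negative kernel supported in `[α, β] ⊂ (0, log 2)` -/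

section Kernel

variable {k : ℝ → ℂ} {α β : ℝ}

/-- Points outside `[α, β]` are outside the support. [folklore] -/
theorem sw_eq_zero_of_notMem (hk : tsupport k ⊆ Icc α β) {t : ℝ} (ht : t ∉ Icc α β) : k t = 0 :=
  image_eq_zero_of_notMem_tsupport fun h => ht (hk h)

/-- **Polar term from below**: for a kernel `k`, real and `≥ 0` pointwise, supported in `[α, β]` with
`α > 0`: `Re (k̂(0) + k̂(1)) ≥ 2cosh(α/2) ∫ Re k`. [folklore] -/
theorem sw_re_weilPolarTerm_ge (hkt : IsWeilTest k) (hk : tsupport k ⊆ Icc α β) (hα : 0 < α)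
    (hre : ∀ t, k t = (((k t).re : ℝ) : ℂ)) (hnn : ∀ t, 0 ≤ (k t).re) :
    2 * Real.cosh (α / 2) * ∫ t, (k t).re ≤ (weilPolarTerm k).re := by
  have hkc : Continuous k := hkt.1.continuous
  have hki : Integrable (fun t => (k t).re) :=
    (hkc.integrable_of_hasCompactSupport hkt.2).re
  -- the two Mellin values as real integrals
  have hM : ∀ c : ℝ, weilMellin k ((c : ℂ) + 1 / 2) = ((∫ t, (k t).re * Real.exp (c * t) : ℝ) : ℂ) := by
    intro c
    unfold weilMellin
    rw [← integral_complex_ofReal]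
    congr 1 with t
    rw [hre t, Complex.ofReal_re]
    rw [show ((c : ℂ) + 1 / 2 - 1 / 2) * (t : ℂ) = ((c * t : ℝ) : ℂ) by push_cast; ring,
      ← Complex.ofReal_exp]
    push_cast
    ring
  have h0 : weilMellin k 0 = ((∫ t, (k t).re * Real.exp (-(1 / 2) * t) : ℝ) : ℂ) := by
    have := hM (-(1 / 2)); rwa [show ((-(1 / 2) : ℝ) : ℂ) + 1 / 2 = 0 by push_cast; ring] at this
  have h1 : weilMellin k 1 = ((∫ t, (k t).re * Real.exp ((1 / 2) * t) : ℝ) : ℂ) := by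
    have := hM (1 / 2); rwa [show (((1 / 2 : ℝ)) : ℂ) + 1 / 2 = 1 by push_cast; ring] at this
  have hi0 : Integrable fun t => (k t).re * Real.exp (-(1 / 2) * t) :=
    ((Complex.continuous_re.comp hkc).mul (by fun_prop)).integrable_of_hasCompactSupport
      ((hkt.2.comp_left (g := Complex.re) Complex.zero_re).mul_right)
  have hi1 : Integrable fun t => (k t).re * Real.exp ((1 / 2) * t) :=
    ((Complex.continuous_re.comp hkc).mul (by fun_prop)).integrable_of_hasCompactSupport
      ((hkt.2.comp_left (g := Complex.re) Complex.zero_re).mul_right)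
  unfold weilPolarTerm
  rw [h0, h1, ← Complex.ofReal_add, Complex.ofReal_re, ← integral_add hi0 hi1, ← integral_const_mul]
  refine integral_mono (hki.const_mul _) (hi0.add hi1) fun t => ?_
  dsimp only
  by_cases ht : t ∈ Icc α β
  · have hcosh : Real.cosh (α / 2) ≤ Real.cosh (t / 2) := by
      rw [Real.cosh_le_cosh, abs_of_nonneg (by linarith), abs_of_nonneg (by linarith [ht.1])]
      linarith [ht.1]
    have e1 : Real.exp (-(1 / 2) * t) = Real.exp (-(t / 2)) := by congr 1; ring
    have e2 : Real.exp ((1 / 2) * t) = Real.exp (t / 2) := by congr 1; ring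
    have e3 : (k t).re * Real.exp (-(t / 2)) + (k t).re * Real.exp (t / 2) =
        2 * Real.cosh (t / 2) * (k t).re := by
      rw [Real.cosh_eq]; ring
    rw [e1, e2, e3]
    exact mul_le_mul_of_nonneg_right (by linarith) (hnn t)
  · have h0' : (k t).re = 0 := by rw [sw_eq_zero_of_notMem hk ht, Complex.zero_re]
    simp [h0']

/-- **Prime term vanishes** for a kernel supported in `[α, β] ⊂ (0, log 2)` (no prime length below
`log 2`; `weilPrimeTerm_eq_zero_of_tsupport_subset`). [folklore] -/
theorem sw_weilPrimeTerm_eq_zero (hkt : IsWeilTest k) (hk : tsupport k ⊆ Icc α β) (hα : 0 < α)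
    (hβ : β < Real.log 2) : weilPrimeTerm k = 0 :=
  weilPrimeTerm_eq_zero_of_tsupport_subset hkt.1.continuous
    (hk.trans (Icc_subset_Icc (by linarith [Real.log_pos one_lt_two]) hβ.le))

/-- **Archimedean term from below** (Bombieri's form): for a kernel `k`, real and `≥ 0` pointwise,
supported in `[α, β]` with `α > 0` (so `k(0) = 0` and `k(−t) = 0` for `t > 0`):
`Re W_∞(k) = −∫₀^∞ w(t) k(t) dt ≥ −w(α) ∫ Re k`. [folklore] -/
theorem sw_re_weilArchTerm_ge (hkt : IsWeilTest k) (hk : tsupport k ⊆ Icc α β) (hα : 0 < α)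
    (hre : ∀ t, k t = (((k t).re : ℝ) : ℂ)) (hnn : ∀ t, 0 ≤ (k t).re) :
    -(weilArchDensity α * ∫ t, (k t).re) ≤ (weilArchTerm k).re := by
  have hkc : Continuous k := hkt.1.continuous
  have hki : Integrable (fun t => (k t).re) :=
    (hkc.integrable_of_hasCompactSupport hkt.2).re
  have hk0 : k 0 = 0 := sw_eq_zero_of_notMem hk fun h => by linarith [h.1]
  have hkneg : ∀ t ∈ Ioi (0 : ℝ), k (-t) = 0 := fun t ht =>
    sw_eq_zero_of_notMem hk fun h => by linarith [h.1, mem_Ioi.1 ht]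
  -- the Bombieri integrand on `(0, ∞)` is the real function `w · Re k`
  have hcongr : ∫ t in Ioi (0 : ℝ), ((Real.exp (t / 2) : ℂ) * (k t + k (-t)) - 2 * k 0) /
      (2 * Real.sinh t : ℂ) = ∫ t in Ioi (0 : ℝ), ((weilArchDensity t * (k t).re : ℝ) : ℂ) := by
    refine setIntegral_congr_fun measurableSet_Ioi fun t ht => ?_
    rw [hkneg t ht, hk0, add_zero, mul_zero, sub_zero, hre t, Complex.ofReal_re]
    unfold weilArchDensity
    push_cast
    ring
  rw [← weilArchTermBombieri_eq_weilArchTerm_holds hkt, weilArchTermBombieri_eq, hcongr, hk0,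
    mul_zero, zero_sub, integral_complex_ofReal, Complex.neg_re, Complex.ofReal_re, neg_le_neg_iff]
  -- pointwise `w(t) Re k(t) ≤ w(α) Re k(t)` on `(0, ∞)`
  have hpt : ∀ t ∈ Ioi (0 : ℝ), weilArchDensity t * (k t).re ≤ weilArchDensity α * (k t).re := by
    intro t ht
    by_cases htI : t ∈ Icc α β
    · exact mul_le_mul_of_nonneg_right
        (weilArchDensity_antitoneOn (mem_Ioi.2 hα) (mem_Ioi.2 (mem_Ioi.1 ht)) htI.1) (hnn t)
    · have : (k t).re = 0 := by rw [sw_eq_zero_of_notMem hk htI, Complex.zero_re]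
      simp [this]
  have hnn' : ∀ t ∈ Ioi (0 : ℝ), 0 ≤ weilArchDensity t * (k t).re := fun t ht =>
    mul_nonneg (weilArchDensity_pos (mem_Ioi.1 ht)).le (hnn t)
  -- integrability of `w · Re k` on `(0, ∞)` by domination
  have hwc : ContinuousOn weilArchDensity (Ioi 0) := by
    unfold weilArchDensity
    refine ContinuousOn.div (by fun_prop) (by fun_prop) fun t ht => ?_
    exact mul_ne_zero two_ne_zero (Real.sinh_pos_iff.2 (mem_Ioi.1 ht)).ne'
  have hmeas : AEStronglyMeasurable (fun t => weilArchDensity t * (k t).re) (volume.restrict (Ioi 0)) :=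
    (hwc.mul (Complex.continuous_re.comp hkc).continuousOn).aestronglyMeasurable measurableSet_Ioi
  have hint : IntegrableOn (fun t => weilArchDensity t * (k t).re) (Ioi 0) := by
    refine Integrable.mono' ((hki.const_mul (weilArchDensity α)).integrableOn) hmeas ?_
    refine (ae_restrict_iff' measurableSet_Ioi).2 (Eventually.of_forall fun t ht => ?_)
    rw [Real.norm_eq_abs, abs_of_nonneg (hnn' t ht)]
    exact hpt t ht
  calc ∫ t in Ioi (0 : ℝ), weilArchDensity t * (k t).re
      ≤ ∫ t in Ioi (0 : ℝ), weilArchDensity α * (k t).re :=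
        setIntegral_mono_on hint (hki.const_mul _).integrableOn measurableSet_Ioi hpt
    _ = weilArchDensity α * ∫ t in Ioi (0 : ℝ), (k t).re := integral_const_mul _ _
    _ ≤ weilArchDensity α * ∫ t, (k t).re := by
        refine mul_le_mul_of_nonneg_left ?_ (weilArchDensity_pos hα).le
        exact setIntegral_le_integral hki (Eventually.of_forall fun t => hnn t)

/-- **The explicit formula on a non-negative kernel below the first prime**: for a test kernel `k`,
real and `≥ 0` pointwise, supported in `[α, β] ⊂ (0, log 2)`:
`Re W(k) ≥ (2cosh(α/2) − w(α)) ∫ Re k`. [folklore] -/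
theorem sw_re_weilFunctional_ge (hkt : IsWeilTest k) (hk : tsupport k ⊆ Icc α β) (hα : 0 < α)
    (hβ : β < Real.log 2) (hre : ∀ t, k t = (((k t).re : ℝ) : ℂ)) (hnn : ∀ t, 0 ≤ (k t).re) :
    (2 * Real.cosh (α / 2) - weilArchDensity α) * ∫ t, (k t).re ≤ (weilFunctional k).re := by
  have h1 := sw_re_weilPolarTerm_ge hkt hk hα hre hnn
  have h2 := sw_weilPrimeTerm_eq_zero hkt hk hα hβ
  have h3 := sw_re_weilArchTerm_ge hkt hk hα hre hnn
  unfold weilFunctional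
  rw [Complex.add_re, Complex.sub_re, h2, Complex.zero_re]
  linarith

end Kernel

/-! ## The barrier -/

/-- Positivity of the integral of a continuous non-negative integrable function that is positive
somewhere. [folklore] -/
theorem sw_integral_pos {f : ℝ → ℝ} (hc : Continuous f) (hi : Integrable f) (h0 : ∀ x, 0 ≤ f x)
    {x : ℝ} (hx : 0 < f x) : 0 < ∫ t, f t := by
  rw [integral_pos_iff_support_of_nonneg (fun t => h0 t) hi]
  exact hc.isOpen_support.measure_pos volume ⟨x, hx.ne'⟩

/-- **The windowed Weil form is not sign-improving (parametric barrier).**  Let `0 < α < β < log 2`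
with `w(α) < 2cosh(α/2)`, and let the window satisfy `β/2 ≤ a`.  Then there are smooth non-negative
real tests `p, q` with DISJOINT supports inside `[-a, a]`, both non-zero, such that
`Re Q(p + q) > Re Q(p − q)`, i.e. `Re Q(|f|) > Re Q(f)` for the sign-changing window test `f = p − q`
(`|f| = p + q`). [folklore] -/
theorem sw_not_signImproving {α β a : ℝ} (hα : 0 < α) (hαβ : α < β) (hβ : β < Real.log 2)
    (hthr : weilArchDensity α < 2 * Real.cosh (α / 2)) (ha : β / 2 ≤ a) :
    ∃ p q : ℝ → ℝ, IsWeilTest (fun t => ((p t : ℝ) : ℂ)) ∧ IsWeilTest (fun t => ((q t : ℝ) : ℂ)) ∧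
      tsupport p ⊆ Icc (-a) a ∧ tsupport q ⊆ Icc (-a) a ∧ (∀ t, 0 ≤ p t) ∧ (∀ t, 0 ≤ q t) ∧
      (∀ t, p t * q t = 0) ∧ (∀ t, |p t - q t| = p t + q t) ∧ (∃ t, 0 < p t) ∧ (∃ t, 0 < q t) ∧
      (weilQuadratic (fun t => ((p t - q t : ℝ) : ℂ))).re <
        (weilQuadratic (fun t => ((p t + q t : ℝ) : ℂ))).re := by
  -- geometry: bumps of radius `ρ` at `±d/2`, `d = (α+β)/2`, `ρ = (β−α)/4`
  set ρ : ℝ := (β - α) / 4 with hρ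
  set d : ℝ := (α + β) / 2 with hd
  have hρ0 : 0 < ρ := by rw [hρ]; linarith
  let pb : ContDiffBump (d / 2) := ⟨ρ / 2, ρ, by positivity, by linarith⟩
  let qb : ContDiffBump (-(d / 2)) := ⟨ρ / 2, ρ, by positivity, by linarith⟩
  set p : ℝ → ℝ := fun t => pb t with hpdef
  set q : ℝ → ℝ := fun t => qb t with hqdef
  have hpc : ContDiff ℝ (⊤ : ℕ∞) p := pb.contDiff
  have hqc : ContDiff ℝ (⊤ : ℕ∞) q := qb.contDiff
  have hps : HasCompactSupport p := pb.hasCompactSupport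
  have hqs : HasCompactSupport q := qb.hasCompactSupport
  have hP : IsWeilTest fun t => ((p t : ℝ) : ℂ) := sw_isWeilTest_ofReal_comp hpc hps
  have hQ : IsWeilTest fun t => ((q t : ℝ) : ℂ) := sw_isWeilTest_ofReal_comp hqc hqs
  have htp : tsupport p = Icc (d / 2 - ρ) (d / 2 + ρ) := by
    rw [hpdef, show (fun t => pb t) = (pb : ℝ → ℝ) from rfl, pb.tsupport_eq, Real.closedBall_eq_Icc]
  have htq : tsupport q = Icc (-(d / 2) - ρ) (-(d / 2) + ρ) := by
    rw [hqdef, show (fun t => qb t) = (qb : ℝ → ℝ) from rfl, qb.tsupport_eq, Real.closedBall_eq_Icc]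
  have hp0 : ∀ t, 0 ≤ p t := fun t => pb.nonneg
  have hq0 : ∀ t, 0 ≤ q t := fun t => qb.nonneg
  -- values outside the supports
  have hpz : ∀ t, t ∉ Icc (d / 2 - ρ) (d / 2 + ρ) → p t = 0 := fun t ht =>
    image_eq_zero_of_notMem_tsupport (by rwa [htp])
  have hqz : ∀ t, t ∉ Icc (-(d / 2) - ρ) (-(d / 2) + ρ) → q t = 0 := fun t ht =>
    image_eq_zero_of_notMem_tsupport (by rwa [htq])
  have hdisj : ∀ t, p t * q t = 0 := by
    intro t
    by_cases ht : t ∈ Icc (d / 2 - ρ) (d / 2 + ρ)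
    · have : t ∉ Icc (-(d / 2) - ρ) (-(d / 2) + ρ) := fun h => by
        have h1 := ht.1; have h2 := h.2
        rw [hρ, hd] at h1 h2
        linarith
      rw [hqz t this, mul_zero]
    · rw [hpz t ht, zero_mul]
  have habs : ∀ t, |p t - q t| = p t + q t := by
    intro t
    rcases mul_eq_zero.1 (hdisj t) with h | h
    · rw [h, zero_sub, abs_neg, abs_of_nonneg (hq0 t), zero_add]
    · rw [h, sub_zero, abs_of_nonneg (hp0 t), add_zero]
  have hppos : 0 < p (d / 2) := pb.pos_of_mem_ball (Metric.mem_ball_self pb.rOut_pos)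
  have hqpos : 0 < q (-(d / 2)) := qb.pos_of_mem_ball (Metric.mem_ball_self qb.rOut_pos)
  -- the cross kernel
  set K : ℝ → ℂ := weilConv (fun u => ((p u : ℝ) : ℂ)) (weilReflect fun u => ((q u : ℝ) : ℂ)) with hK
  have hKt : IsWeilTest K := hP.weilConv hQ.weilReflect
  have hKs : tsupport K ⊆ Icc α β := by
    refine (tsupport_weilConv_subset hP.2).trans ?_
    rw [tsupport_weilReflect, sw_tsupport_ofReal_comp, sw_tsupport_ofReal_comp, htp, htq]
    rintro x ⟨u, hu, v, hv, rfl⟩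
    rw [Set.mem_neg, mem_Icc] at hv
    rw [mem_Icc] at hu ⊢
    rw [hρ, hd] at hu hv
    constructor <;> linarith
  have hKre : ∀ t, K t = (((K t).re : ℝ) : ℂ) := fun t => sw_cross_eq_ofReal_re p q t
  have hKnn : ∀ t, 0 ≤ (K t).re := fun t => sw_cross_re_nonneg hp0 hq0 t
  -- `∫ Re K > 0`: `Re K(d) = ∫ p(u) q(u − d) du > 0`
  have hKc : Continuous fun t => (K t).re := Complex.continuous_re.comp hKt.1.continuous
  have hKi : Integrable fun t => (K t).re := (hKt.1.continuous.integrable_of_hasCompactSupport hKt.2).re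
  have hKd : 0 < (K d).re := by
    rw [hK, sw_cross_apply, Complex.ofReal_re]
    have hc : Continuous fun u => p u * q (u - d) :=
      hpc.continuous.mul (hqc.continuous.comp (continuous_id.sub continuous_const))
    have hi : Integrable fun u => p u * q (u - d) :=
      hc.integrable_of_hasCompactSupport hps.mul_right
    refine sw_integral_pos hc hi (fun u => mul_nonneg (hp0 u) (hq0 _)) (x := d / 2) ?_
    rw [show d / 2 - d = -(d / 2) by ring]
    exact mul_pos hppos hqpos
  have hKint : 0 < ∫ t, (K t).re := sw_integral_pos hKc hKi hKnn hKd
  -- assemble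
  have hW := sw_re_weilFunctional_ge hKt hKs hα hβ hKre hKnn
  have hdiff := sw_weilQuadratic_add_sub_sub hP hQ
  have hre : (weilQuadratic (fun u => ((p u + q u : ℝ) : ℂ))).re -
      (weilQuadratic (fun u => ((p u - q u : ℝ) : ℂ))).re = 4 * (weilFunctional K).re := by
    have := congrArg Complex.re hdiff
    simpa [Complex.sub_re, Complex.mul_re] using this
  have hgap : 0 < (2 * Real.cosh (α / 2) - weilArchDensity α) * ∫ t, (K t).re :=
    mul_pos (by linarith) hKint
  have hta : tsupport p ⊆ Icc (-a) a := by
    rw [htp, hρ, hd]; exact Icc_subset_Icc (by linarith) (by linarith)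
  have htqa : tsupport q ⊆ Icc (-a) a := by
    rw [htq, hρ, hd]; exact Icc_subset_Icc (by linarith) (by linarith)
  exact ⟨p, q, hP, hQ, hta, htqa, hp0, hq0, hdisj, habs, ⟨_, hppos⟩, ⟨_, hqpos⟩, by linarith⟩

/-- `w(2/5) < 2 cosh(1/5)` (`e^{1/5} ≤ 1.24 < 2(e^{2/5} − e^{−2/5})`, so `w(2/5) < 2 ≤ 2cosh`). [folklore] -/
theorem sw_weilArchDensity_two_fifths_lt : weilArchDensity (2 / 5) < 2 * Real.cosh (1 / 5) := by
  have h1 : Real.exp (1 / 5) ≤ 1 + 1 / 5 + (1 / 5) ^ 2 := by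
    have h := Real.abs_exp_sub_one_sub_id_le (x := 1 / 5) (by rw [abs_of_pos (by norm_num)]; norm_num)
    have := (abs_le.1 h).2
    linarith
  have h2 : (1 : ℝ) + 2 / 5 ≤ Real.exp (2 / 5) := by linarith [Real.add_one_le_exp (2 / 5 : ℝ)]
  have h4 : Real.exp (-(2 / 5 : ℝ)) ≤ 5 / 7 := by
    rw [Real.exp_neg, inv_le_comm₀ (Real.exp_pos _) (by norm_num)]
    have : (5 / 7 : ℝ)⁻¹ = 7 / 5 := by norm_num
    rw [this]
    linarith
  have hs : 0 < Real.sinh (2 / 5) := Real.sinh_pos_iff.2 (by norm_num)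
  have hc : 1 ≤ Real.cosh (1 / 5) := Real.one_le_cosh _
  unfold weilArchDensity
  rw [show (2 / 5 : ℝ) / 2 = 1 / 5 by norm_num, div_lt_iff₀ (by positivity), Real.sinh_eq]
  nlinarith

/-- **Barrier at every window `a ≥ 3/10`.**  For every `a ≥ 3/10` there is a real window test
`f = p − q` on `[-a, a]` (difference of smooth non-negative bumps with disjoint supports, so `|f| = p + q`
is again a test) with `Re Q(|f|) > Re Q(f)`: the windowed Weil form is NOT sign-improving, and no
Beurling–Deny argument yields one-signed ground states there. [folklore] -/
theorem sw_not_signImproving_of_ge {a : ℝ} (ha : 3 / 10 ≤ a) :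
    ∃ p q : ℝ → ℝ, IsWeilTest (fun t => ((p t : ℝ) : ℂ)) ∧ IsWeilTest (fun t => ((q t : ℝ) : ℂ)) ∧
      tsupport p ⊆ Icc (-a) a ∧ tsupport q ⊆ Icc (-a) a ∧ (∀ t, 0 ≤ p t) ∧ (∀ t, 0 ≤ q t) ∧
      (∀ t, p t * q t = 0) ∧ (∀ t, |p t - q t| = p t + q t) ∧ (∃ t, 0 < p t) ∧ (∃ t, 0 < q t) ∧
      (weilQuadratic (fun t => ((p t - q t : ℝ) : ℂ))).re <
        (weilQuadratic (fun t => ((p t + q t : ℝ) : ℂ))).re := by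
  have hlog : (3 / 5 : ℝ) < Real.log 2 := by
    have := Real.log_two_gt_d9; linarith
  have hthr : weilArchDensity (2 / 5) < 2 * Real.cosh ((2 / 5) / 2) := by
    rw [show (2 / 5 : ℝ) / 2 = 1 / 5 by norm_num]; exact sw_weilArchDensity_two_fifths_lt
  exact sw_not_signImproving (α := 2 / 5) (β := 3 / 5) (by norm_num) (by norm_num) hlog hthr
    (by linarith)

end Summit.RiemannHypothesis.RiemannHypothesis.Theorems.PolarPerronFrobenius

end
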